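import Summits.QuantumFields.QCD.Theses.EulerDescent

/-!
# Birth skeleton (BC3) for crux `ChiralCornerSoftness` (item stmt-QuantumFields-16902) — `Lines/birth.lean`

Route `route-QuantumFields-EulerDescent` (sub-problem QCD), crux decl
`Summit.QuantumFields.QCD.Theses.EulerDescent.ChiralCornerSoftness` (rank 4, open-problem, refuter-checked
2026-08-16): for `N_f ∈ {2,3}`, every regularisation PINNED AT THE INTRINSIC WILSON CORNER — eventually in `k`,
`mc k` is the least upper bound of the degenerate bare Wilson masses at which lattice QCD at coupling `β_k` is NOT
massive; `(m_crit(k) − mc(k))·Z_m(k)/a_k → 0`; `HasMassScaling`; two-loop `HasAsymptoticScaling`; `m_crit(k) > −1`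
eventually — is chiral at zero: `reg.IsChiralAtZero`, i.e. for every `ε > 0` some POSITIVE mass tuple has no uniform
lattice gap `ε`.

Registered by the skeleton-registrar seat `planner-skel-stmt-QuantumFields-16902-0` (route re-audit bin REPAIRABLE,
2026-08-17).  LINE = WHERE the gap vanishes + HOW softness leaves the chiral point (the natural two-layer cut of a
"gap closes as `m → 0⁺`" statement into a statement AT the pinned chiral trajectory and a TRANSPORT statement in the
renormalised mass; both halves carry the crux's full pinned package as hypotheses — refuter note on 16900/16902:
"none of corner/pin/MS/AS droppable"):

* `stub_chiralTrajectoryGapless` (S1 — THE GOLDSTONE / ANOMALY INPUT, AT `m = 0`; open): the pinned chiral trajectory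
  itself — bare masses `m_f(k) = m_crit(k)`, i.e. `reg.scheme 0 0 0` — has NO uniform lattice gap at ANY physical rate:
  `∀ ε > 0, ¬ (reg.scheme 0 0 0).HasLatticeMassGap ε`.  Content: the pin puts `m_crit(k)` within `o(a_k/Z_m(k))` — a
  vanishing RENORMALISED offset — of the corner `mc(k)`, the accumulation point of non-massive degenerate bare masses;
  softness of the corner FROM ABOVE IN PHYSICAL UNITS (second-order Aoki boundary: massless pions; first-order
  Sharpe–Singleton point: `m_π,min(a_k) → 0` in physical units) makes the physical clustering rate along `m_crit(k)`
  tend to `0`, witnessed by one fixed pair of local observables (the pseudoscalar density) frequently in `k`.  This is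
  where massless `N_f = 2, 3` QCD being gapless (Goldstone theorem if chiral symmetry breaks, 't Hooft anomaly matching
  otherwise) enters; no OS-level proof exists.
* `stub_softnessPersists` (S2 — UPPER SEMICONTINUITY OF THE PHYSICAL GAP AT `0⁺` ALONG THE DEGENERATE RAY; size L–XL):
  on a pinned regularisation, if the chiral trajectory has no uniform lattice gap `ε`, then for every `ε' > ε` some
  DEGENERATE positive tuple `(η,…,η)`, `η > 0`, has no uniform lattice gap `ε'`: `inf_{η>0} Δ(η,…,η) ≤ Δ(0)`.  Content:
  the bare tuples of `reg.scheme (η,…,η) 0 0` and of `reg.scheme 0 0 0` differ by `a_k η / Z_m(k) → 0` in lattice units,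
  and the response of connected correlators / of the lowest level of Lüscher's positive transfer matrix
  (`m_crit > −1`: positivity range) to the bare mass is controlled by the integrated scalar density (Feynman–Hellmann,
  the route's support item `MassDerivativeIdentity`, stmt-QuantumFields-8909) with a slope that is `O(a_k Z_m(k))` in
  lattice units (GMOR: `(a m_π)² ≈ (2B/f²) a Z_m (μ − μ_c)`), uniformly in the volume — so opening the gap costs
  renormalised mass.  Why it might fail: an anomalously steep (non-GMOR) opening of the lattice gap above the corner,
  i.e. a condensate diverging in physical units, or failure witnessed only by volume blow-ups (`(−1)^F`-twisted
  functional on tori `S > L_k`) that a bare-mass perturbation of size `a η/Z_m` destroys for every `η > 0`.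

`ChiralCornerSoftness_of : Stmt.stub_chiralTrajectoryGapless → Stmt.stub_softnessPersists → ChiralCornerSoftness` is
kernel-checked (no `sorry`; axioms `propext, Classical.choice, Quot.sound`): given `ε > 0`, S1 at rate `ε/2` says the
chiral trajectory has no uniform gap `ε/2`; S2 with `ε/2 < ε` yields `η > 0` with no uniform gap `ε` at `(η,…,η)`,
which is a positive tuple — `IsChiralAtZero`.  Both stubs are load-bearing (S1 alone speaks of `m = 0` only, which
`IsChiralAtZero` never reads; S2 alone has no softness to transport).

Layout forced by the skeleton audit (`#h21_check_skeleton`: the composition's hypotheses must be registered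
obligations BY NAME): §1 states each stub ONCE MORE as a named proposition `Stmt.stub_<name>` (verbatim the raw
signature of the registered `theorem stub_<name>` of §2, definitionally — see `chiralCornerSoftness_of_stubs`), and
§3's composition quantifies over those names; the registered stubs themselves carry the RAW self-contained signatures
over `Literature.MathematicalPhysics.QuantumFieldTheory.*` and need no import of this file to be restated.

## Check (registrar folder, farm, 2026-08-17)
* This file: `lean check --json` rc 0, errors [], sorries 2 = the two `stub_*` (the only warnings are their two
  `declaration uses sorry`), zero `sorry` elsewhere; `#print axioms ChiralCornerSoftness_of` = propext, Classical.choice,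
  Quot.sound; advisory file audit: `chiralCornerSoftness_of_stubs` = proof-of-item of the crux decl (not closed: `sorryAx`
  via the stubs, intended), `ChiralCornerSoftness_of` closed modulo its two named hypotheses.
* BC3 probes (`bc/birth_probe_S{1,2}_{crux,summit}.lean`, importing ONLY the route file, each stub's RAW signature as the
  hypothesis, six examples per file under `set_option maxHeartbeats 400000` each — p0 `first | exact? | simpa | aesop`,
  p1 `first | exact? | simpa [T] | (unfold T; simpa) | aesop`, p2 `exact?`, p3 `aesop`, p4 `simpa`, p5 `intro h; exact?`,
  `T ∈ {ChiralCornerSoftness, QCD (+ QCDOf)}`): all 24 examples FAIL (rc 1 ×4) — `exact?` "could not close the goal" ×8,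
  `aesop` "failed to prove the goal after exhaustive search" (⊢ ChiralCornerSoftness / ⊢ QCD after the `Nf = 2 ∨ Nf = 3`
  case split) ×6, `simpa` "assumption failed" ×4, whnf heartbeat time-outs ×6.  No stub is cheaply the crux or the
  sub-problem statement.

## Negative knowledge honoured
* `ledger negatives --problem QuantumFields` (2026-08-17; 5 entries: 14958 RobustYangMillsRG, 9665 DiagonalMirrorRP,
  9494 AdaptiveCoarseSystem, 9599 MultibosonLatticeGap, 9603 AdmissibleRootsExist): none concerns gaplessness of a
  pinned chiral trajectory or mass-continuity of lattice gaps; no stub is an instance of a refuted statement.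
* `Cruxes/ChiralCornerSoftness/`: no `Disproof.lean`, no prior workfiles, no crux ideas (`ledger crux ls`, 2026-08-17),
  hence no `_false_without_` obligations to honour yet.
* Landed pin-shape lemmas (read, consistent): `ChiralGluonicCompletion.Negative.isChiralAtZero_of_gaplessPoint` /
  `isChiralAtZero_of_blowup` (the typed pin is also met by ONE gapless or sign-singular POSITIVE tuple — neither stub
  claims such a tuple; S1 is at `m = 0`, which the pin never reads, so S1 ↛ crux by these lemmas),
  `isChiralAtZero_of_uniform` (the Goldstone-uniform reading implies the pin — deliberately NOT a stub: it restates the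
  crux in stronger form), `ChiralMobilityGap.Negative.isChiralAtZero_iff_frequently` (liminf-in-`k` form),
  `RobustYangMillsHandover.Negative.not_isChiralAtZero_mcrit_shift_of_uniformGapAbove` (an `m_crit` up-shift of a
  uniformly gapped regularisation is never chiral — honoured: nothing is shifted, the pin is intrinsic).
-/

namespace Summit.QuantumFields.QCD.Cruxes.ChiralCornerSoftness.Birth

open Filter
open Literature.MathematicalPhysics.QuantumFieldTheory
open Summit.QuantumFields.QCD.Theses.EulerDescent (ChiralCornerSoftness)

/-! ## §1 The two stub STATEMENTS as named propositions (the admissible hypotheses of `ChiralCornerSoftness_of`;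
each is, verbatim, the raw signature of the registered stub of the same short name in §2) -/

namespace Stmt

/-- **Statement of stub S1 — the pinned chiral trajectory is gapless in physical units.**  For `N_f ∈ {2,3}` and
every regularisation pinned at the intrinsic Wilson corner (corner `IsLUB` eventually, pin `→ 0`, `HasMassScaling`,
two-loop asymptotic scaling, `m_crit > −1` eventually), the trajectory at renormalised mass `0` (bare masses
`m_crit(k)`) has no uniform lattice mass gap at any rate `ε > 0`. [folklore] -/
def stub_chiralTrajectoryGapless : Prop :=
  ∀ Nf : ℕ, Nf = 2 ∨ Nf = 3 → ∀ (reg : QCDRegularisation Nf) (mc : ℕ → ℝ),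
    (∀ᶠ k in atTop, IsLUB {μ : ℝ | ¬ (∀ (R R' : ℕ) (A : QCDLatticeObservable Nf R)
        (B : QCDLatticeObservable Nf R'), ∃ (C δ : ℝ) (S₀ : ℕ), 0 < δ ∧ ∀ S : ℕ, S₀ ≤ S → ∀ n : ℕ, n ≤ S →
          ‖qcdLatticeConnectedCorr (reg.β k) (2 * S + 1) (fun _ : Fin Nf => μ) A B n‖ ≤
            C * Real.exp (-(δ * n)))} (mc k)) →
    Tendsto (fun k => (reg.mcrit k - mc k) * reg.Zm k / reg.a k) atTop (nhds 0) →
    reg.HasMassScaling → (reg.scheme 0 0 0).HasAsymptoticScaling →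
    (∀ᶠ k in atTop, (-1 : ℝ) < reg.mcrit k) →
    ∀ ε : ℝ, 0 < ε → ¬ (reg.scheme 0 0 0).HasLatticeMassGap ε

/-- **Statement of stub S2 — softness persists above zero (upper semicontinuity of the physical gap at `0⁺` along the
degenerate ray).**  For `N_f ∈ {2,3}` and every regularisation pinned at the intrinsic Wilson corner: if the chiral
trajectory has no uniform lattice gap `ε > 0`, then for every `ε' > ε` some degenerate positive tuple `(η,…,η)`,
`η > 0`, has no uniform lattice gap `ε'`. [folklore] -/
def stub_softnessPersists : Prop :=
  ∀ Nf : ℕ, Nf = 2 ∨ Nf = 3 → ∀ (reg : QCDRegularisation Nf) (mc : ℕ → ℝ),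
    (∀ᶠ k in atTop, IsLUB {μ : ℝ | ¬ (∀ (R R' : ℕ) (A : QCDLatticeObservable Nf R)
        (B : QCDLatticeObservable Nf R'), ∃ (C δ : ℝ) (S₀ : ℕ), 0 < δ ∧ ∀ S : ℕ, S₀ ≤ S → ∀ n : ℕ, n ≤ S →
          ‖qcdLatticeConnectedCorr (reg.β k) (2 * S + 1) (fun _ : Fin Nf => μ) A B n‖ ≤
            C * Real.exp (-(δ * n)))} (mc k)) →
    Tendsto (fun k => (reg.mcrit k - mc k) * reg.Zm k / reg.a k) atTop (nhds 0) →
    reg.HasMassScaling → (reg.scheme 0 0 0).HasAsymptoticScaling →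
    (∀ᶠ k in atTop, (-1 : ℝ) < reg.mcrit k) →
    ∀ ε ε' : ℝ, 0 < ε → ε < ε' → ¬ (reg.scheme 0 0 0).HasLatticeMassGap ε →
      ∃ η : ℝ, 0 < η ∧ ¬ (reg.scheme (fun _ : Fin Nf => η) 0 0).HasLatticeMassGap ε'

end Stmt

/-! ## §2 The registered stubs (the ONLY `sorry`s of this file; raw self-contained signatures) -/

/-- **(S1) the pinned chiral trajectory is gapless in physical units** (`= Stmt.stub_chiralTrajectoryGapless` by `rfl`;
open — Goldstone / anomaly matching at the intrinsic corner, plus softness of the corner from above in physical units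
under an `o(a/Z_m)` pin). -/
theorem stub_chiralTrajectoryGapless :
    ∀ Nf : ℕ, Nf = 2 ∨ Nf = 3 → ∀ (reg : QCDRegularisation Nf) (mc : ℕ → ℝ),
      (∀ᶠ k in atTop, IsLUB {μ : ℝ | ¬ (∀ (R R' : ℕ) (A : QCDLatticeObservable Nf R)
          (B : QCDLatticeObservable Nf R'), ∃ (C δ : ℝ) (S₀ : ℕ), 0 < δ ∧ ∀ S : ℕ, S₀ ≤ S → ∀ n : ℕ, n ≤ S →
            ‖qcdLatticeConnectedCorr (reg.β k) (2 * S + 1) (fun _ : Fin Nf => μ) A B n‖ ≤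
              C * Real.exp (-(δ * n)))} (mc k)) →
      Tendsto (fun k => (reg.mcrit k - mc k) * reg.Zm k / reg.a k) atTop (nhds 0) →
      reg.HasMassScaling → (reg.scheme 0 0 0).HasAsymptoticScaling →
      (∀ᶠ k in atTop, (-1 : ℝ) < reg.mcrit k) →
      ∀ ε : ℝ, 0 < ε → ¬ (reg.scheme 0 0 0).HasLatticeMassGap ε := by
  sorry

/-- **(S2) softness persists above zero along the degenerate ray** (`= Stmt.stub_softnessPersists` by `rfl`; size L–XL —
Feynman–Hellmann / Kato on Lüscher's transfer matrix with a GMOR-size slope `O(a Z_m)` uniform in the volume). -/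
theorem stub_softnessPersists :
    ∀ Nf : ℕ, Nf = 2 ∨ Nf = 3 → ∀ (reg : QCDRegularisation Nf) (mc : ℕ → ℝ),
      (∀ᶠ k in atTop, IsLUB {μ : ℝ | ¬ (∀ (R R' : ℕ) (A : QCDLatticeObservable Nf R)
          (B : QCDLatticeObservable Nf R'), ∃ (C δ : ℝ) (S₀ : ℕ), 0 < δ ∧ ∀ S : ℕ, S₀ ≤ S → ∀ n : ℕ, n ≤ S →
            ‖qcdLatticeConnectedCorr (reg.β k) (2 * S + 1) (fun _ : Fin Nf => μ) A B n‖ ≤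
              C * Real.exp (-(δ * n)))} (mc k)) →
      Tendsto (fun k => (reg.mcrit k - mc k) * reg.Zm k / reg.a k) atTop (nhds 0) →
      reg.HasMassScaling → (reg.scheme 0 0 0).HasAsymptoticScaling →
      (∀ᶠ k in atTop, (-1 : ℝ) < reg.mcrit k) →
      ∀ ε ε' : ℝ, 0 < ε → ε < ε' → ¬ (reg.scheme 0 0 0).HasLatticeMassGap ε →
        ∃ η : ℝ, 0 < η ∧ ¬ (reg.scheme (fun _ : Fin Nf => η) 0 0).HasLatticeMassGap ε' := by
  sorry

/-! ## §3 Composition (kernel-checked): the crux BY NAME from the two stub statements -/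

/-- **THE CRUX FROM THE TWO STUBS** — concludes `Summit.QuantumFields.QCD.Theses.EulerDescent.ChiralCornerSoftness` BY
NAME with a real proof: for `ε > 0`, S1 at rate `ε/2` (no uniform gap `ε/2` along the chiral trajectory), then S2 with
`ε/2 < ε` gives `η > 0` such that the degenerate positive tuple `(η,…,η)` has no uniform lattice gap `ε`. [folklore] -/
theorem ChiralCornerSoftness_of :
    Stmt.stub_chiralTrajectoryGapless → Stmt.stub_softnessPersists → ChiralCornerSoftness := by
  intro hGapless hPersists Nf hNf reg mc hcorner hpin hms haf hbr ε hε
  have hε2 : (0 : ℝ) < ε / 2 := half_pos hε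
  have hlt : ε / 2 < ε := half_lt_self hε
  obtain ⟨η, hη, hng⟩ := hPersists Nf hNf reg mc hcorner hpin hms haf hbr (ε / 2) ε hε2 hlt
    (hGapless Nf hNf reg mc hcorner hpin hms haf hbr (ε / 2) hε2)
  exact ⟨fun _ => η, fun _ => hη, hng⟩

/-- The crux along this skeleton, from the registered stubs (sorries only inside `stub_*`; this term also certifies
that each `Stmt.stub_<name>` is definitionally the raw signature of `stub_<name>`). -/
theorem chiralCornerSoftness_of_stubs : ChiralCornerSoftness :=
  ChiralCornerSoftness_of stub_chiralTrajectoryGapless stub_softnessPersists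

end Summit.QuantumFields.QCD.Cruxes.ChiralCornerSoftness.Birth
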